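import Summits.QuantumFields.BalabanUV.T4Continuum.Spine.NE7.QLaCriticality
import Literature.MathematicalPhysics.QuantumFieldTheory.Balaban1983to89.AveragingRT

/-!
# Spine/NE7/QLaCriticalityAxial — NON-VACUITY companion of `Spine/NE7/QLaCriticality`: every hypothesis of the second-order
# loop defect bound is discharged at once for the tree's axial (decimation) average over `SU(n)`; strings of loops inherit
# criticality

Cell `pub-balaban-gaps` (YM blitz Y1, track G2, seat `ne7`, generation 3); text of record
`run/shared/lean/pub/pub-balaban-gaps/ne/NE7.md` v3 §4quater.  Sixth `Spine/NE7/` file; split from `QLaCriticality` for the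
400-line rule, imports it and the tree's `AveragingRT` only.

CONTENTS ([folklore] bookkeeping; 0 sorry; nothing of Bałaban's densities asserted).
* §1 `pathProd_one`, `avgFlat_axial`: the axial average `AveragingRT.axial` (the tree's inhabitant of `∀ j, Averaging P j G`,
  `AveragingRT.nonempty_averaging_family`) FIXES THE FLAT CONFIGURATION — the new shape `AvgFlat` is inhabited.
* §2 `line_inj` (the straight lines of distinct (coarse bond, step) pairs are distinct fine bonds — the tree had the last-bond
  case `AveragingRT.last_injective` ∕ `line_ne_last`), `bdist_pathProd_le`, `tv_axialAvg_le` (DECIMATION DOES NOT INCREASE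
  TOTAL VARIATION), `avgStepContraction_axial` (`T4AvgDerivBound.AvgStepContraction` with `θ = 1` on ALL configurations, no
  gauge transformation needed), `domStable_univ`, `gaugeStable_univ`, `loopDefectBound_axial`, and the UNCONDITIONAL instance
  `loopDefectBound_axial_specialUnitaryGroup`: `1 − W(decⁿ V) ≤ ½(|w|·tv(1,V))²` over `SU(n)` — the hypotheses of
  `loopDefectBound_of_stepContraction` are jointly inhabited with a non-trivial domain and the group the series means.
* §3 `one_sub_mul_le_add`, `abs_prod_le_one`, `one_sub_prod_le_sum`: STRINGS (products of loop variables, the per-string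
  observables of `T4MatchingAssembly` ∕ `T4CauchySum`) inherit criticality: `1 − ∏W_i ≤ Σ(1 − W_i)` for `|W_i| ≤ 1`; sanity
  examples with the census numbers (`θ₁² = 2⁻⁶`, `a = θ₁²L⁴ = 1∕4` at `L = 2`).

HONEST FRAMING.  The axial average is NOT Bałaban's (15) ([Balaban1985Averaging] p. 19; it is the tree's consistency
certificate for the `Averaging` axioms); this file certifies non-vacuity of the shapes, it proves nothing about the series'
averaging (NE1a-STEP for the printed average stays row O3c's located hypothesis).  NE7 NOT proved; spine 0∕9; fixed finite
T⁴ — NOT ℝ⁴, NOT a mass gap, NOT Clay.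
-/

noncomputable section

open MeasureTheory Finset
open scoped BigOperators Matrix Matrix.Norms.L2Operator

namespace Summit.QuantumFields.BalabanUV.T4Continuum.Spine.NE7

open Literature.MathematicalPhysics.QuantumFieldTheory.Balaban1983to89
open Literature.MathematicalPhysics.QuantumFieldTheory.Balaban1983to89.T4Continuum
open Literature.MathematicalPhysics.QuantumFieldTheory.Balaban1983to89.T4AvgSensitivity
open Literature.MathematicalPhysics.QuantumFieldTheory.Balaban1983to89.T4AvgDerivBound
open Literature.MathematicalPhysics.QuantumFieldTheory.Balaban1983to89.UnitaryModel

/-! ## §1 The axial average fixes the flat configuration (`AvgFlat` is inhabited) -/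

section Flat

variable {P : Params} {G : Type*} [GaugeGroup G]

/-- NON-VACUITY of `AvgFlat`: the partial transports of the trivial configuration along the lines of the tree's axial
(decimation) average `AveragingRT.axial` are trivial … [folklore] -/
theorem pathProd_one {j : ℕ} (c : PBond P (j + 1)) : ∀ n : ℕ, AveragingRT.pathProd (1 : GaugeField P j G) c n = 1
  | 0 => rfl
  | n + 1 => by
    rw [AveragingRT.pathProd, pathProd_one c n, one_mul]
    rfl

/-- … so the axial average FIXES THE FLAT CONFIGURATION: `AvgFlat (fun _ => AveragingRT.axial)` — the new hypothesis shape is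
inhabited by the tree's consistency-certificate averaging (the one inhabiting `∀ j, Averaging P j G`,
`AveragingRT.nonempty_averaging_family`). [folklore] -/
theorem avgFlat_axial : AvgFlat (P := P) (G := G) fun _ => AveragingRT.axial := fun _ _ =>
  funext fun c => pathProd_one c P.L

end Flat

/-! ## §2 Decimation does not increase total variation: EVERY hypothesis of the defect bound at once, `θ = 1`, over `SU(n)` -/

section Axial

variable {P : Params} {G : Type*} [GaugeGroup G]

open AveragingRT

/-- The straight lines of distinct (coarse bond, step) pairs consist of distinct fine bonds: `(c, t) ↦ line c t` is injective on
`t < L` (standing range; the tree had the last-bond case `AveragingRT.last_injective` ∕ `line_ne_last`). [folklore] -/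
theorem line_inj {j : ℕ} (hj : j + 1 ≤ P.m + P.K) {c c' : PBond P (j + 1)} {t t' : ℕ} (ht : t < P.L) (ht' : t' < P.L)
    (h : line c t = line c' t') : c = c' ∧ t = t' := by
  have hL := P.hL.2
  obtain ⟨k, hk⟩ := P.hL.1
  simp only [line, PBond.mk.injEq] at h
  obtain ⟨hs, hdir⟩ := h
  have hsrc_of_tgt : c.tgt = c'.tgt → c.src = c'.src := fun htgt =>
    shift_injective c.dir (by simpa [PBond.tgt, hdir] using htgt)
  have hcc : c.src = c'.src → c = c' := fun hsrc => by
    cases c; cases c'; simp_all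
  by_cases hlo : t ≤ (P.L - 1) / 2 <;> by_cases hlo' : t' ≤ (P.L - 1) / 2
  · rw [lineSite_eq_lo hj c hlo, lineSite_eq_lo hj c' hlo'] at hs
    obtain ⟨hsrc, hoff⟩ := blockSite_inj hj hs
    have := congrFun hoff c.dir
    simp only [offLo, hdir, if_true, Fin.mk.injEq] at this
    exact ⟨hcc hsrc, by omega⟩
  · rw [lineSite_eq_lo hj c hlo, lineSite_eq_hi hj c' (lt_of_not_ge hlo') ht'.le] at hs
    have := congrFun (blockSite_inj hj hs).2 c.dir
    simp only [offLo, offHi, hdir, if_true, Fin.mk.injEq] at this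
    omega
  · rw [lineSite_eq_hi hj c (lt_of_not_ge hlo) ht.le, lineSite_eq_lo hj c' hlo'] at hs
    have := congrFun (blockSite_inj hj hs).2 c.dir
    simp only [offLo, offHi, hdir, if_true, Fin.mk.injEq] at this
    omega
  · rw [lineSite_eq_hi hj c (lt_of_not_ge hlo) ht.le, lineSite_eq_hi hj c' (lt_of_not_ge hlo') ht'.le] at hs
    obtain ⟨htgt, hoff⟩ := blockSite_inj hj hs
    have := congrFun hoff c.dir
    simp only [offHi, hdir, if_true, Fin.mk.injEq] at this
    exact ⟨hcc (hsrc_of_tgt htgt), by omega⟩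

/-- The partial transports along a line differ by at most the sum of the one-bond changes met (`bdist_mul_mul` iterated).
[folklore] -/
theorem bdist_pathProd_le {j : ℕ} (U U' : GaugeField P j G) (c : PBond P (j + 1)) :
    ∀ n : ℕ, bdist (pathProd U c n) (pathProd U' c n) ≤ ∑ t ∈ Finset.range n, bdist (U (line c t)) (U' (line c t))
  | 0 => by simp [pathProd]
  | n + 1 => by
    rw [pathProd, pathProd, Finset.sum_range_succ]
    exact (bdist_mul_mul _ _ _ _).trans (add_le_add (bdist_pathProd_le U U' c n) le_rfl)

/-- **DECIMATION DOES NOT INCREASE TOTAL VARIATION**: `tv (axialAvg U) (axialAvg U′) ≤ tv U U′` (standing range) — each coarse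
bond variable is the transport along its own line, lines are disjoint (`line_inj`), and a transport moves by at most the sum of the
changes of its factors. [folklore] -/
theorem tv_axialAvg_le {j : ℕ} (hj : j + 1 ≤ P.m + P.K) (U U' : GaugeField P j G) :
    tv (axialAvg U) (axialAvg U') ≤ tv U U' := by
  classical
  have hf0 : ∀ b : PBond P j, 0 ≤ bdist (U b) (U' b) := fun b => bdist_nonneg _ _
  have hinj : Set.InjOn (fun p : PBond P (j + 1) × ℕ => line p.1 p.2)
      ↑((Finset.univ : Finset (PBond P (j + 1))) ×ˢ Finset.range P.L) := by
    intro p hp q hq hpq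
    have hp2 : p.2 < P.L := Finset.mem_range.mp (Finset.mem_product.mp (Finset.mem_coe.mp hp)).2
    have hq2 : q.2 < P.L := Finset.mem_range.mp (Finset.mem_product.mp (Finset.mem_coe.mp hq)).2
    obtain ⟨h1, h2⟩ := line_inj hj hp2 hq2 hpq
    exact Prod.ext h1 h2
  unfold tv
  calc ∑ c : PBond P (j + 1), bdist (axialAvg U c) (axialAvg U' c)
      ≤ ∑ c : PBond P (j + 1), ∑ t ∈ Finset.range P.L, bdist (U (line c t)) (U' (line c t)) :=
        Finset.sum_le_sum fun c _ => bdist_pathProd_le U U' c P.L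
    _ = ∑ p ∈ (Finset.univ : Finset (PBond P (j + 1))) ×ˢ Finset.range P.L, bdist (U (line p.1 p.2)) (U' (line p.1 p.2)) :=
        (Finset.sum_product' (Finset.univ : Finset (PBond P (j + 1))) (Finset.range P.L)
          (fun c t => bdist (U (line c t)) (U' (line c t)))).symm
    _ = ∑ b ∈ ((Finset.univ : Finset (PBond P (j + 1))) ×ˢ Finset.range P.L).image (fun p => line p.1 p.2),
          bdist (U b) (U' b) := (Finset.sum_image (f := fun b => bdist (U b) (U' b)) hinj).symm
    _ ≤ ∑ b, bdist (U b) (U' b) :=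
        Finset.sum_le_sum_of_subset_of_nonneg (Finset.subset_univ _) fun b _ _ => hf0 b

/-- The trivial gauge transformation acts trivially. [folklore] -/
theorem gaugeAct_one_transf {j : ℕ} (V : GaugeField P j G) : GaugeField.gaugeAct (fun _ => (1 : G)) V = V := by
  funext b
  simp [GaugeField.gaugeAct]

/-- `AvgStepContraction` for the axial average ON THE WHOLE CONFIGURATION SPACE with `θ = 1` (no gauge transformation needed).
[folklore] -/
theorem avgStepContraction_axial :
    AvgStepContraction (P := P) (G := G) (fun _ => axial) (fun _ => Set.univ) 1 := by
  intro j hj U U' _ _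
  refine ⟨fun _ => 1, ?_⟩
  rw [gaugeAct_one_transf, one_mul]
  exact tv_axialAvg_le hj U U'

/-- `DomStable` and `GaugeStable` hold trivially for the whole configuration space. [folklore] -/
theorem domStable_univ (av : ∀ j, Averaging P j G) : DomStable av fun _ => Set.univ := fun _ _ _ _ => Set.mem_univ _

/-- (see `domStable_univ`) [folklore] -/
theorem gaugeStable_univ : GaugeStable (P := P) (G := G) fun _ => Set.univ := fun _ _ _ _ => Set.mem_univ _

/-- **NON-VACUITY OF §3**: for ANY gauge group with `ReTrCrit G Cc` and the axial average, `LoopDefectBound` holds on the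
whole configuration space with rate `1`: `1 − W(decⁿ V) ≤ Cc·(|w|·tv(1,V))²` — every hypothesis of
`loopDefectBound_of_stepContraction` discharged (no small-field restriction, no gauge fixing). [folklore] -/
theorem loopDefectBound_axial {Cc : ℝ} (hcrit : ReTrCrit G Cc) (hCc : 0 ≤ Cc) :
    LoopDefectBound (P := P) (G := G) (fun _ => axial) (fun _ => Set.univ) Cc 1 :=
  loopDefectBound_of_stepContraction hcrit hCc (domStable_univ (P := P) (G := G) fun _ => axial) gaugeStable_univ
    avgStepContraction_axial zero_le_one avgFlat_axial

/-- … in particular over `SU(n)` with `Cc = ½` (§2): an UNCONDITIONAL kernel instance of the second-order loop defect bound —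
the decimated Wilson loop of a configuration `V` deviates from `1` by at most `½(|w|·tv(1,V))²`. [folklore] -/
theorem loopDefectBound_axial_specialUnitaryGroup {n : Type*} [Fintype n] [DecidableEq n] [Nonempty n] :
    LoopDefectBound (P := P) (G := Matrix.specialUnitaryGroup n ℂ) (fun _ => axial) (fun _ => Set.univ) (1 / 2) 1 :=
  loopDefectBound_axial reTrCrit_specialUnitaryGroup (by norm_num)

end Axial

/-! ## §3 Strings of loops inherit criticality, and sanity checks -/

/-- Two factors: `1 − ab ≤ (1 − a) + (1 − b)` for `a, b ≤ 1` (it is `0 ≤ (1 − a)(1 − b)`). [folklore] -/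
theorem one_sub_mul_le_add {a b : ℝ} (ha : a ≤ 1) (hb : b ≤ 1) : 1 - a * b ≤ (1 - a) + (1 - b) := by
  nlinarith [mul_nonneg (sub_nonneg.mpr ha) (sub_nonneg.mpr hb)]

/-- **STRINGS INHERIT CRITICALITY**: for a finite string of loop variables `W_i ∈ [−1, 1]` (the per-string observables of
`T4MatchingAssembly` ∕ `T4CauchySum` are products of loop variables), the defect of the product is at most the sum of the
defects, `1 − ∏ W_i ≤ Σ (1 − W_i)` — so a product of loops is second order at the flat configuration as soon as each factor
is (§3).  First, a product of reals of modulus `≤ 1` has modulus `≤ 1`. [folklore] -/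
theorem abs_prod_le_one : ∀ l : List ℝ, (∀ x ∈ l, |x| ≤ 1) → |l.prod| ≤ 1
  | [], _ => by simp
  | a :: l, h => by
    rw [List.prod_cons, abs_mul]
    exact mul_le_one₀ (h a (by simp)) (abs_nonneg _) (abs_prod_le_one l fun x hx => h x (by simp [hx]))

/-- **STRINGS INHERIT CRITICALITY**: `1 − ∏ W_i ≤ Σ (1 − W_i)` for `|W_i| ≤ 1`. [folklore] -/
theorem one_sub_prod_le_sum : ∀ l : List ℝ, (∀ x ∈ l, |x| ≤ 1) → 1 - l.prod ≤ (l.map fun x => 1 - x).sum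
  | [], _ => by simp
  | a :: l, h => by
    have ha : |a| ≤ 1 := h a (by simp)
    have hl : ∀ x ∈ l, |x| ≤ 1 := fun x hx => h x (by simp [hx])
    have hP : |l.prod| ≤ 1 := abs_prod_le_one l hl
    rw [List.prod_cons, List.map_cons, List.sum_cons]
    calc 1 - a * l.prod ≤ (1 - a) + (1 - l.prod) := one_sub_mul_le_add (abs_le.mp ha).2 (abs_le.mp hP).2
      _ ≤ (1 - a) + (l.map fun x => 1 - x).sum := by linarith [one_sub_prod_le_sum l hl]


/-- SANITY (at the identity both sides of the criticality inequality vanish). [folklore] -/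
example {n : Type*} [Fintype n] [DecidableEq n] [Nonempty n] :
    1 - nReTr (1 : Matrix n n ℂ) ≤ 1 / 2 * opDist1 (1 : Matrix n n ℂ) ^ 2 := by
  rw [nReTr_one, opDist1_one]; norm_num

/-- SANITY (the census numbers): in d = 4 at `L = 2` the second-order rate per level is `θ₁² = 2⁻⁶` and the slice ratio
`a = θ₁²·L⁴ = 1/4 < 1`. [folklore] -/
example : ((2 : ℝ)⁻¹ ^ 3) ^ 2 = 1 / 64 ∧ ((2 : ℝ)⁻¹ ^ 3) ^ 2 * 2 ^ 4 = 1 / 4 := by norm_num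

end Summit.QuantumFields.BalabanUV.T4Continuum.Spine.NE7

end
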